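import Mathlib
import HarnessLib
import Summits.HubbardSuperconductivity.HubbardSuperconductivity.Theorems.KLProgrammeForwardBubblePlanar
import Summits.HubbardSuperconductivity.HubbardSuperconductivity.Theorems.KLProgrammeMatsubaraSliceWeight

/-!
# Route `KLProgramme` — crux K3, ENGINE child (stmt-HubbardSuperconductivity-19855 `KLRegimeEngineV12`): the forward particle–hole slice bubble of
# the frame band with the CARRIER's slice weights — numerical constants (cell gate-hubbard-kl, seat hubbard-kl-k3c2-p2)

`…ForwardBubblePlanar` bounds the planar forward bubble `β⁻¹•Σ_i ∫d²p A(p)Φ_f(ω_i,e(p))Φ_{f'}(ω_i+q₀,e'(p))` for abstract shell weights `(f, f')`.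
Here the weights are the carrier's: the slice weight `w_n(s) = χ₂(s/Λ_n²) − χ₂(s/Λ_{n−1}²)` of `hubbardCovSliceCT` between `Λ_{n−1} = 4Λ_n` and `Λ_n`
(`klwt_sliceWeight_hypotheses_sharp`: `‖w_n‖ ≤ 1`, `Lip ≤ (34/3)/Λ_n²`, support `(Λ_n/2)² < s < (4Λ_n)²`; product `ℓ_F = 68/3`), giving the
SAME-SLICE pair `(w_n, w_n)` of the step-`n` rung with absolute constants:
`‖…‖ ≤ 2^25·L_W·Λ_n + 2^25·B_W·(π/β)/Λ_n + 2^21·B_W·(|q₀| + δ_max)/Λ_n` (`klfb_planar_sliceBubble_norm_le`), `B_W = A₀π√2/d`,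
`L_W = (π√2/d)A₁/d + A₀(1/d² + π√2(2+κ₂)/d³)`, `d = Dt_min − κ₁`.  Reading against the engine package `klEngGeo3` (ZS-RECIPE-v5 §B): per unit
(vertex sup)² and d²k/(2π)² normalisation the three terms are the `C₀4^{−n}` branch (`Λ_n = 4^{−n}/32`), the thermal layer
(`(π/β)/Λ_n ≤ 4·4^{−(n_β−n)}`, `klte_ratio_le_four_mul_inv_pow`; `2^25·4/(4π²)·B_W ≈ 2^{22}·B_W ≪ CF = 2^52`) and the `K·ρ/Λ_n` branch.
Pure analysis; nothing about the model's effective action is asserted.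
-/

noncomputable section

namespace Summit.HubbardSuperconductivity.HubbardSuperconductivity.Theorems.KLRegimeSplit

set_option linter.dupNamespace false -- summit = problem name (single-conjunct summit), D-0017

open Real Set Filter MeasureTheory intervalIntegral Complex Literature.MathematicalPhysics.QuantumLattice
open Literature.MathematicalPhysics.QuantumLattice.BandSectorCounting Literature.Probability.LatticeModels
open Summit.HubbardSuperconductivity.HubbardSuperconductivity.Theorems.PerturbedFermiCurve
open Summit.HubbardSuperconductivity.HubbardSuperconductivity.Theorems.KLProgrammeLegKernels

/-! ## §1 The carrier's slice-weight pair `(w_n, w_n)` (same-slice line pair): numerical constants -/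

section Carrier

variable {a b : ℝ} (B : BandBounds a b) {δ : (Fin 2 → ℝ) → ℝ} (hδ1 : ContDiff ℝ 1 δ) {κ₀ κ₁ : ℝ}
  (hδ : ∀ k : Fin 2 → ℝ, (∀ i, |k i| ≤ π) → |δ k| ≤ κ₀)
  (hκ : ∀ k : Fin 2 → ℝ, (∀ i, |k i| ≤ π) → ‖fderiv ℝ δ k‖ ≤ κ₁) (hκ₁ : κ₁ < B.Dtmin)

include B hδ1 hδ hκ hκ₁ in
/-- **The same-slice forward bubble of the frame band with the CARRIER's slice weight** `w_n(s) = χ₂(s/Λ_n²) − χ₂(s/Λ_{n−1}²)` on both lines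
(`n ≥ 1`; `M_f = 1`, `ℓ' = 34/3`, `ℓ_F = 68/3`, `klwt_sliceWeight_hypotheses_sharp`): with `d = Dt_min − κ₁`, `B_W = A₀π√2/d`,
`L_W = (π√2/d)A₁/d + A₀(1/d² + π√2(2+κ₂)/d³)`,
`‖β⁻¹•Σ_i ∫d²p A(p)Φ_{w_n}(ω_i,e(p))Φ_{w_n}(ω_i+q₀,e'(p))‖ ≤ 2^25·L_W·Λ_n + 2^25·B_W·(π/β)/Λ_n + 2^21·B_W·(|q₀| + δ_max)/Λ_n`. -/
theorem klfb_planar_sliceBubble_norm_le {A : ℝ × ℝ → ℂ} (hA : Continuous A) (hAsupp : ∀ p : ℝ × ℝ, A p ≠ 0 → |p.1| < π ∧ |p.2| < π)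
    {A₀ A₁ : ℝ} (hA0 : ∀ p, ‖A p‖ ≤ A₀)
    (hA1 : ∀ θ t t' : ℝ, 0 ≤ t → 0 ≤ t' →
      ‖A (t * Real.cos θ, t * Real.sin θ) - A (t' * Real.cos θ, t' * Real.sin θ)‖ ≤ A₁ * |t - t'|)
    {κ₂ : ℝ} (hκ₂ : 0 ≤ κ₂)
    (hD2 : ∀ θ s t : ℝ, s ∈ Icc 0 (π / ‖dir θ‖) → t ∈ Icc 0 (π / ‖dir θ‖) →
      |fderiv ℝ δ (s • dir θ) (dir θ) - fderiv ℝ δ (t • dir θ) (dir θ)| ≤ κ₂ * |s - t|)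
    {n : ℕ} (hn1 : 1 ≤ n) {e' : ℝ × ℝ → ℝ} (he' : Continuous e') {μ δmax : ℝ} (hδ0 : 0 ≤ δmax)
    (he'δ : ∀ p : ℝ × ℝ, |p.1| < π → |p.2| < π → |e' p - klfb_band δ μ p| ≤ δmax)
    (hlo : a < μ - 4 * klScale klE0 n - κ₀) (hhi : μ + 4 * klScale klE0 n + κ₀ < b)
    (q₀ : ℝ) {β : ℝ} (hβ : klBetaMin ≤ β) (hn : n ≤ nScales β + 1) {M : ℕ}
    (hM : β * (4 * klScale klE0 n) / (2 * Real.pi) + 1 ≤ M) :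
    ‖β⁻¹ • ∑ i : MatsubaraIdx M, ∫ p : ℝ × ℝ,
        klfb_integrand δ μ A
          (fun s => ((salmhoferCutoff (s / klScale klE0 n ^ 2) - salmhoferCutoff (s / klScale klE0 (n - 1) ^ 2) : ℝ) : ℂ))
          (fun s => ((salmhoferCutoff (s / klScale klE0 n ^ 2) - salmhoferCutoff (s / klScale klE0 (n - 1) ^ 2) : ℝ) : ℂ))
          e' (matsubaraFreq β M i) q₀ p‖ ≤
      2 ^ 25 * (Real.pi * Real.sqrt 2 / (B.Dtmin - κ₁) * A₁ / (B.Dtmin - κ₁) +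
            A₀ * (1 / (B.Dtmin - κ₁) ^ 2 + Real.pi * Real.sqrt 2 * (2 + κ₂) / (B.Dtmin - κ₁) ^ 3)) * klScale klE0 n +
        2 ^ 25 * (A₀ * (Real.pi * Real.sqrt 2 / (B.Dtmin - κ₁))) * ((Real.pi / β) / klScale klE0 n) +
          2 ^ 21 * (A₀ * (Real.pi * Real.sqrt 2 / (B.Dtmin - κ₁))) * (|q₀| + δmax) / klScale klE0 n := by
  obtain ⟨hb, hl, hi, ho⟩ := klwt_sliceWeight_hypotheses_sharp hn1
  have hΛ := klth_klScale_pos n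
  have hd : 0 < B.Dtmin - κ₁ := by linarith
  have hA0' : 0 ≤ A₀ := (norm_nonneg _).trans (hA0 0)
  have hA1' : 0 ≤ A₁ := klfb_radialLip_nonneg hA1
  have hFbd : ∀ s, ‖((salmhoferCutoff (s / klScale klE0 n ^ 2) - salmhoferCutoff (s / klScale klE0 (n - 1) ^ 2) : ℝ) : ℂ) *
      ((salmhoferCutoff (s / klScale klE0 n ^ 2) - salmhoferCutoff (s / klScale klE0 (n - 1) ^ 2) : ℝ) : ℂ)‖ ≤ 1 := fun s =>
    (klwt_mul_norm_le hb hb s).trans (by norm_num)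
  have h := klfb_planar_bubble_norm_le B hδ1 hδ hκ hκ₁ hA hAsupp hA0 hA1 hκ₂ hD2 hl hb hi ho hl hb le_rfl hi ho zero_le_one
    (klwt_sliceWeightSq_lipschitz_sharp hn1) hFbd le_rfl he' hδ0 he'δ hlo hhi q₀ hβ hn hM
  refine h.trans ?_
  -- numerical collapse: `2π·(524288/π)(68/3+8) ≤ 2^25`, `2π·(393216/π)(68/3+8) ≤ 2^25`, `2π·(1024/π)·1·(48·34/3+193) ≤ 2^21`
  set LW := Real.pi * Real.sqrt 2 / (B.Dtmin - κ₁) * A₁ / (B.Dtmin - κ₁) +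
    A₀ * (1 / (B.Dtmin - κ₁) ^ 2 + Real.pi * Real.sqrt 2 * (2 + κ₂) / (B.Dtmin - κ₁) ^ 3) with hLW_def
  set BW := A₀ * (Real.pi * Real.sqrt 2 / (B.Dtmin - κ₁)) with hBW_def
  have hLW : 0 ≤ LW := by rw [hLW_def]; positivity
  have hBW : 0 ≤ BW := by rw [hBW_def]; positivity
  have hπ := Real.pi_pos
  have hq : 0 ≤ |q₀| + δmax := by positivity
  have hβ0 : 0 < β := pos_of_klBetaMin_le hβ
  have e1 : 2 * Real.pi * (524288 / Real.pi * (68 / 3 + 8 * 1) * LW * klScale klE0 n) = (2 * 524288 * (68 / 3 + 8)) * (LW * klScale klE0 n) := by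
    field_simp
  have e2 : 2 * Real.pi * (393216 / Real.pi * (68 / 3 + 8 * 1) * BW * ((Real.pi / β) / klScale klE0 n)) =
      (2 * 393216 * (68 / 3 + 8)) * (BW * ((Real.pi / β) / klScale klE0 n)) := by
    field_simp
  have e3 : 2 * Real.pi * (1024 / Real.pi * 1 * (48 * (34 / 3) + 193 * 1) * BW * (|q₀| + δmax) / klScale klE0 n) =
      (2 * 1024 * (48 * (34 / 3) + 193)) * (BW * (|q₀| + δmax) / klScale klE0 n) := by
    field_simp
  have t1 : 0 ≤ LW * klScale klE0 n := by positivity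
  have t2 : 0 ≤ BW * ((Real.pi / β) / klScale klE0 n) := by positivity
  have t3 : 0 ≤ BW * (|q₀| + δmax) / klScale klE0 n := by positivity
  rw [mul_add, mul_add, e1, e2, e3]
  have c1 : (2 : ℝ) * 524288 * (68 / 3 + 8) ≤ 2 ^ 25 := by norm_num
  have c2 : (2 : ℝ) * 393216 * (68 / 3 + 8) ≤ 2 ^ 25 := by norm_num
  have c3 : (2 : ℝ) * 1024 * (48 * (34 / 3) + 193) ≤ 2 ^ 21 := by norm_num
  have f1 : (2 : ℝ) ^ 25 * LW * klScale klE0 n = 2 ^ 25 * (LW * klScale klE0 n) := by ring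
  have f2 : (2 : ℝ) ^ 25 * BW * ((Real.pi / β) / klScale klE0 n) = 2 ^ 25 * (BW * ((Real.pi / β) / klScale klE0 n)) := by ring
  have f3 : (2 : ℝ) ^ 21 * BW * (|q₀| + δmax) / klScale klE0 n = 2 ^ 21 * (BW * (|q₀| + δmax) / klScale klE0 n) := by ring
  rw [f1, f2, f3]
  exact add_le_add (add_le_add (mul_le_mul_of_nonneg_right c1 t1) (mul_le_mul_of_nonneg_right c2 t2)) (mul_le_mul_of_nonneg_right c3 t3)

end Carrier

end Summit.HubbardSuperconductivity.HubbardSuperconductivity.Theorems.KLRegimeSplit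

end
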